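import Summits.QuantumFields.YangMills.Theorems.BalabanUVNodesN22ActivityStripMixed
import Literature.MathematicalPhysics.QuantumFieldTheory.Balaban1983to89.Node00.HistoryTermsOfRecord

/-!
# BalabanUVNodes ∕ node N22 = NE9 — THE ACTIVITY-STRIP SLOT AT THE W1 OBJECT: the history functional of record
# `Node00.W1.functionalOn ∕ functional` ([II] (2.13)–(2.14) with the coupling history on the Record11 torus catalogue, definer seat
# `node00-def-W1`, `Node00/HistoryTermsOfRecord.lean`) CARRIES the activity-strip slot of `BalabanUVNodesN22ActivityStripSlot` as soon as the
# step activities `W1.ClusterStep.H` are holomorphic in each young coupling on a strip under ONE (2.38)-majorant — the representation clause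
# holds BY `rfl`; the termwise producer of that holomorphy from (2.26)-type tables; the (A) letter and the printed p. 266 clause for `functional`

Cell `pub-ymgap`, HUMAN RULING D-0062 (Track A), R134 fan-out seat `pub-ymgap-dag-n22-c` (strategy s1: «the history-Lipschitz estimate (2.40)–(2.41)
p. 21 of [II] on the W1 object»), generation 0, third module = the W1 INSTANCE of the first two.  THEOREMS ONLY (no `def`, no `def … : Prop`);
imports this seat's `…Theorems.BalabanUVNodesN22ActivityStripMixed` (p455244 + v1.1 p455608 ⇒ `…ActivityStripSlot` p452837) and the W1 OBJECT
`Literature.….Node00.HistoryTermsOfRecord` (p455641 ✓ fcd0e8e47d29) BY NAME.  `--supports stmt-QuantumFields-19676` (K3 `SpineGivenEndpointR11`).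

WHAT IS INSTANCED.  The slot of `YMDAG.N22.supLetter_of_activityStrip` asks, per window history `g`, background `U`, domain `X` and young
coupling `i < scale X`, for a torus domain `X₀` reading `X`, an open `O ⊇` the closed `r`-discs about `]0, γ]`, and a complexified activity family
`Hc` holomorphic on `O` under one majorant whose cluster sum has REAL PART the section.  AT THE W1 OBJECT — carriers `W1.histCarriers P M p`
(`Dom = Σ j, 𝐃_j`, `scale = Sigma.fst`, `d ⟨j, X⟩ = torusTreeLen X`), functional `W1.functionalOn S p emb g U ⟨k+1, X⟩ = Re (S k).E (g₀,…,g_k)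
(emb U) X` with `(S k).E := B13Resummation.locE (tgeometry …).ι (tgeometry …).cubes (S k).H …` ((2.13) DEFINITIONAL) — the torus domain is
`X₀ := X` itself (torus side `Sect2.domCount (F.P K) M (k+1)`; the record's dimension `(F.P K).d = 4` and `tgeometry`'s incompatibility ∕
footprint `= TTouch ∕ (·.1)` hold by `rfl`), the decay transfer is `κ ≤ r₁`, and the representation clause is `rfl` once `Hc t = (S k).Hh (g | g_i
:= t) (emb U)`.  What remains DISPLAYED is exactly ONE hypothesis on the step activities — «YOUNG-COUPLING STRIP HOLOMORPHY UNDER ONE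
(2.38)-MAJORANT»: for every step `k`, window history, background, `X ∈ 𝐃_{k+1}` and `i ≤ k`, a family `Hc : ℂ → 𝐃_{k+1} → ℂ` holomorphic on an
open `O ⊇` the closed `r`-discs about `]0, γ]` polymer by polymer inside `X`, dominated there by `A·e^{−R·d_{k+1}(Z)}`, and EQUAL at real `t` to
W1's `(S k).Hh (g | g_i := t) (emb U)` = W1's `Bound238` read on the strip of the `i`-th coupling: [II] Lemma 3 (2.38) p. 20 complexified in an
OLDER coupling (`i < k`: node N10's T-row on the strip; printed TYPE *"(or analytic)"* for the LAST coupling only, [I] p. 263) ∕ in the last one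
(`i = k`: node N09's `EHoloAt` currency; the MIXED module lets that case be fed at the OUTPUT level instead).

WHAT.
* §1 `hAct_functionalOn_of_youngHolo` — young-coupling strip holomorphy of the step activities ⟹ the `hAct` clause of
  `supLetter_of_activityStrip` for `W1.functionalOn S p emb` (ANY background type `B` read through `emb : B → Sect2.CPair`, e.g. the admissible
  backgrounds of the run), torus sides `Nsz := Sect2.domCount (F.P K) M`; `hAct_functional_of_youngHolo` — the same for the functional of record
  `W1.functional S ι p` (`emb := Sect2.ofBackgroundC ι`, `rfl`).
* §2 `youngHolo_of_termwise` — the TERMWISE producer: per step, holomorphic complexified TERMS `Tc j` (`j ∈ (S k).idx Z`) on `O` with a summed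
  majorant `Σ_{j ∈ idx Z} ‖Tc j z‖ ≤ A·e^{−R·d(Z)}` ((2.26) p. 17 table resummed as in Lemma 3 — node N10's currency, `W1.ClusterStep.Majorant226`
  read on the strip) and `Tc j t = (S k).T j (g | g_i := t)|_{≤k} (emb U)` ⟹ the hypothesis of §1 with `Hc z Z := Σ_{j ∈ idx Z} Tc j z`.
* §3 `supLetter_functionalOn_of_youngHolo` ∕ `supLetter_functional_of_youngHolo` — ROAD 3's (A) letter for the W1 functional with
  `M = e·9·64·K₀(64,8)²·A`, `μ = 1` (slot §1 BY NAME); `analyticInEachCoupling266_functional_of_youngHolo` — the PRINTED [I] p. 266 clause for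
  `W1.functional` (MIXED §2 BY NAME; direction of record only).
* §4 `youngHolo_termlessTower` — NON-VACUITY (A5 rider): the displayed hypothesis is satisfiable (the termless model tower, `H ≡ 0`,
  `Hc ≡ 0`, `O = ℂ`), so §1–§3 are not vacuous implications; a MODEL tower, not NODE 00's.

HONEST FRAMING.  Count-neutral by-name knit at the OBJECT; NOT a discharge of N22 (no `RRec` home instanced here; the young-coupling strip
holomorphy is DISPLAYED — it is the complexified (2.38), i.e. the T-row of node N10 on a strip, asserted nowhere; (O) = node N18 enters only in
the slot module's closers).  NE5 ∕ NE9 NOT IN PRINT, NOT PROVED; one finite four-torus programme at fixed ε — NOT infinite volume, NOT OS on ℝ⁴,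
NOT a mass gap, NOT Clay.  0 `sorry`, 0 `def`, standard axioms.

References (TYPES only): [I] = [Balaban1987RG1] T. Bałaban, Commun. Math. Phys. **109** (1987) 249–301 — §0 p. 256, p. 263, p. 266; [II] =
[Balaban1988RG2Cluster] T. Bałaban, Commun. Math. Phys. **116** (1988) 1–22 — (2.11)–(2.14) pp. 14–15, (2.26) p. 17, Lemma 3 (2.38) p. 20,
(2.41) p. 21.
-/

noncomputable section

namespace YMDAG.N22.W1

open Set Metric
open scoped BigOperators
open Literature.MathematicalPhysics.QuantumFieldTheory.Balaban1983to89
open Literature.MathematicalPhysics.QuantumFieldTheory.Balaban1983to89.T4Continuum (T4Family)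
open Literature.MathematicalPhysics.QuantumFieldTheory.Balaban1983to89.T4OutputRate
open Literature.MathematicalPhysics.QuantumFieldTheory.Balaban1983to89.B13Resummation (locE)
open Literature.MathematicalPhysics.QuantumFieldTheory.Balaban1983to89.TreeLengthTorus (TPt TDom tsys torusTreeLen torusTreeLen_nonneg)
open Literature.MathematicalPhysics.QuantumFieldTheory.Balaban1983to89.TreeLengthTorusGeometry (TTouch)
open Literature.MathematicalPhysics.QuantumFieldTheory.Balaban1983to89.B12TreeDecay (K₀)
open Literature.MathematicalPhysics.QuantumFieldTheory.Balaban1983to89.B12CouplingClausesHistory (AnalyticInEachCoupling266)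
open Literature.MathematicalPhysics.QuantumFieldTheory.Balaban1983to89.Node00
open Literature.MathematicalPhysics.QuantumFieldTheory.Balaban1983to89.Node00.Sect2 (domSys domCount CPair ofBackgroundC)
open Literature.MathematicalPhysics.QuantumFieldTheory.Balaban1983to89.Node00.W1

variable (F : T4Family) (K : ℕ) {𝔸 : Type*} {M : ℕ}

/-! ## §1 The `hAct` clause of the activity-strip slot for W1's history functional -/

open Classical in
/-- **THE W1 FUNCTIONAL CARRIES THE ACTIVITY-STRIP SLOT** (background read through any `emb : B → Φ`).  IF at every step `k`, for every window
history `g ∈ Window γ`, background `U : B`, domain `X ∈ 𝐃_{k+1}` of the record's torus catalogue and young coupling `i ≤ k`, the step activities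
admit a YOUNG-COUPLING STRIP-HOLOMORPHIC family under ONE majorant — `Hc : ℂ → 𝐃_{k+1} → ℂ` holomorphic on an open `O ⊇` the closed
`r`-discs about `]0, γ]` polymer by polymer inside `X`, `‖Hc z Z‖ ≤ A·e^{−R·d_{k+1}(Z)}` on `O`, `Hc t = (S k).Hh (g | g_i := t) (emb U)` for real
`t ∈ ]0, γ]` (= W1's `Bound238` read on the strip of the `i`-th coupling; DISPLAYED, asserted nowhere) — THEN `W1.functionalOn S p emb` satisfies
the `hAct` clause of `YMDAG.N22.supLetter_of_activityStrip` with torus sides `Sect2.domCount (F.P K) M`, for every `κ ≤ r₁`: the torus domain is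
`X` itself and the representation clause `Re locE TTouch (·.1) (Hc t) X = functionalOn … (g | g_i := t) U ⟨k+1, X⟩` is `rfl` ((2.13) DEFINITIONAL
in W1; `(F.P K).d = 4`, `tgeometry.ι = TTouch`, `tgeometry.cubes = (·.1)` by `rfl`). [folklore] -/
theorem hAct_functionalOn_of_youngHolo (S : ClusterTower (F.P K) 𝔸 M) (p : RunPairing) {B : Type} (emb : B → CPair (F.P K) 𝔸)
    {γ κ A R r₁ r : ℝ} (hκ : κ ≤ r₁)
    (hYH : ∀ (k : ℕ) (g : ℕ → ℝ), g ∈ Window γ → ∀ (U : B) (X : (domSys (F.P K) M (k + 1)).Dom) (i : ℕ), i < k + 1 →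
      ∃ (Hc : ℂ → (domSys (F.P K) M (k + 1)).Dom → ℂ) (O : Set ℂ), IsOpen O ∧ (∀ t ∈ Ioc (0 : ℝ) γ, closedBall (t : ℂ) r ⊆ O) ∧
        (∀ Z : (domSys (F.P K) M (k + 1)).Dom, Z.1 ⊆ X.1 → DifferentiableOn ℂ (fun z => Hc z Z) O) ∧
        (∀ z ∈ O, ∀ Z : (domSys (F.P K) M (k + 1)).Dom, Z.1 ⊆ X.1 → ‖Hc z Z‖ ≤ A * Real.exp (-(R * torusTreeLen Z.1))) ∧
        (∀ t ∈ Ioc (0 : ℝ) γ, Hc t = (S k).Hh (Function.update g i t) (emb U))) :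
    ∀ g ∈ Window γ, ∀ (U : B) (X : (histCarriers (F.P K) M p).Dom) (i : ℕ), i < (histCarriers (F.P K) M p).scale X →
      ∃ (X₀ : (tsys 4 (domCount (F.P K) M ((histCarriers (F.P K) M p).scale X))).Dom)
        (Hc : ℂ → (tsys 4 (domCount (F.P K) M ((histCarriers (F.P K) M p).scale X))).Dom → ℂ) (O : Set ℂ),
        IsOpen O ∧ (∀ t ∈ Ioc (0 : ℝ) γ, closedBall (t : ℂ) r ⊆ O) ∧
        (∀ Z : (tsys 4 (domCount (F.P K) M ((histCarriers (F.P K) M p).scale X))).Dom, Z.1 ⊆ X₀.1 →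
          DifferentiableOn ℂ (fun z => Hc z Z) O) ∧
        (∀ z ∈ O, ∀ Z : (tsys 4 (domCount (F.P K) M ((histCarriers (F.P K) M p).scale X))).Dom, Z.1 ⊆ X₀.1 →
          ‖Hc z Z‖ ≤ A * Real.exp (-(R * torusTreeLen Z.1))) ∧
        κ * (histCarriers (F.P K) M p).d X ≤ r₁ * torusTreeLen X₀.1 ∧
        (∀ t ∈ Ioc (0 : ℝ) γ,
          (locE (TTouch (d := 4) (N := domCount (F.P K) M ((histCarriers (F.P K) M p).scale X)))
              (fun Z : (tsys 4 (domCount (F.P K) M ((histCarriers (F.P K) M p).scale X))).Dom => Z.1) (Hc t) X₀.1).re =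
            functionalOn S p emb (Function.update g i t) U X) := by
  intro g hg U X i hi
  obtain ⟨j, X'⟩ := X
  cases j with
  | zero => exact absurd hi (Nat.not_lt_zero i)
  | succ k =>
    obtain ⟨Hc, O, hO, hdisc, hhol, hmaj, hrep⟩ := hYH k g hg U X' i hi
    refine ⟨X', Hc, O, hO, hdisc, hhol, hmaj, ?_, fun t ht => ?_⟩
    · exact mul_le_mul_of_nonneg_right hκ (torusTreeLen_nonneg _)
    · rw [hrep t ht]
      rfl

open Classical in
/-- **THE FUNCTIONAL OF RECORD `W1.functional S ι p` CARRIES THE ACTIVITY-STRIP SLOT** — §1 at `emb := Sect2.ofBackgroundC ι` (the real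
`G`-valued gauge field read in `Φ` with `𝐉 = 0`), by `rfl` (`W1.functional S ι p = W1.functionalOn S p (ofBackgroundC ι)`). [folklore] -/
theorem hAct_functional_of_youngHolo [Ring 𝔸] (S : ClusterTower (F.P K) 𝔸 M) {G : Type} [Group G] (ι : G →* 𝔸ˣ) (p : RunPairing)
    {γ κ A R r₁ r : ℝ} (hκ : κ ≤ r₁)
    (hYH : ∀ (k : ℕ) (g : ℕ → ℝ), g ∈ Window γ → ∀ (U : GaugeField (F.P K) 0 G) (X : (domSys (F.P K) M (k + 1)).Dom) (i : ℕ), i < k + 1 →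
      ∃ (Hc : ℂ → (domSys (F.P K) M (k + 1)).Dom → ℂ) (O : Set ℂ), IsOpen O ∧ (∀ t ∈ Ioc (0 : ℝ) γ, closedBall (t : ℂ) r ⊆ O) ∧
        (∀ Z : (domSys (F.P K) M (k + 1)).Dom, Z.1 ⊆ X.1 → DifferentiableOn ℂ (fun z => Hc z Z) O) ∧
        (∀ z ∈ O, ∀ Z : (domSys (F.P K) M (k + 1)).Dom, Z.1 ⊆ X.1 → ‖Hc z Z‖ ≤ A * Real.exp (-(R * torusTreeLen Z.1))) ∧
        (∀ t ∈ Ioc (0 : ℝ) γ, Hc t = (S k).Hh (Function.update g i t) (ofBackgroundC ι U))) :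
    ∀ g ∈ Window γ, ∀ (U : GaugeField (F.P K) 0 G) (X : (histCarriers (F.P K) M p).Dom) (i : ℕ), i < (histCarriers (F.P K) M p).scale X →
      ∃ (X₀ : (tsys 4 (domCount (F.P K) M ((histCarriers (F.P K) M p).scale X))).Dom)
        (Hc : ℂ → (tsys 4 (domCount (F.P K) M ((histCarriers (F.P K) M p).scale X))).Dom → ℂ) (O : Set ℂ),
        IsOpen O ∧ (∀ t ∈ Ioc (0 : ℝ) γ, closedBall (t : ℂ) r ⊆ O) ∧
        (∀ Z : (tsys 4 (domCount (F.P K) M ((histCarriers (F.P K) M p).scale X))).Dom, Z.1 ⊆ X₀.1 →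
          DifferentiableOn ℂ (fun z => Hc z Z) O) ∧
        (∀ z ∈ O, ∀ Z : (tsys 4 (domCount (F.P K) M ((histCarriers (F.P K) M p).scale X))).Dom, Z.1 ⊆ X₀.1 →
          ‖Hc z Z‖ ≤ A * Real.exp (-(R * torusTreeLen Z.1))) ∧
        κ * (histCarriers (F.P K) M p).d X ≤ r₁ * torusTreeLen X₀.1 ∧
        (∀ t ∈ Ioc (0 : ℝ) γ,
          (locE (TTouch (d := 4) (N := domCount (F.P K) M ((histCarriers (F.P K) M p).scale X)))
              (fun Z : (tsys 4 (domCount (F.P K) M ((histCarriers (F.P K) M p).scale X))).Dom => Z.1) (Hc t) X₀.1).re =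
            functional S ι p (Function.update g i t) U X) :=
  hAct_functionalOn_of_youngHolo F K S p (ofBackgroundC ι) hκ hYH

/-! ## §2 The termwise producer of the young-coupling strip holomorphy -/

/-- **TERMWISE ⟹ ACTIVITY-WISE.**  If at every step the TERMS (2.14) admit complexified families `Tc j : ℂ → ℂ` (`j ∈ (S k).idx Z`), holomorphic
on an open `O ⊇` the closed `r`-discs about `]0, γ]`, with a SUMMED majorant `Σ_{j ∈ idx Z} ‖Tc j z‖ ≤ A·e^{−R·d_{k+1}(Z)}` on `O` ((2.26) p. 17
table resummed as in Lemma 3 — node N10's currency; W1's `Majorant226` read on the strip) and `Tc j t = (S k).T j (g | g_i := t)|_{≤k} (emb U)`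
at real `t`, then the activities `H(Z) = Σ_{j} T j` ((2.11)) carry the young-coupling strip holomorphy of §1 with `Hc z Z := Σ_{j ∈ idx Z} Tc j z`
(finite sums of holomorphic functions; `‖Σ‖ ≤ Σ‖·‖`). [folklore] -/
theorem youngHolo_of_termwise {P : Params} (S : ClusterTower P 𝔸 M) {B : Type} (emb : B → CPair P 𝔸) {γ A R r : ℝ}
    (hT : ∀ (k : ℕ) (g : ℕ → ℝ), g ∈ Window γ → ∀ (U : B) (X : (domSys P M (k + 1)).Dom) (i : ℕ), i < k + 1 →
      ∃ (Tc : (S k).Idx → ℂ → ℂ) (O : Set ℂ), IsOpen O ∧ (∀ t ∈ Ioc (0 : ℝ) γ, closedBall (t : ℂ) r ⊆ O) ∧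
        (∀ Z : (domSys P M (k + 1)).Dom, Z.1 ⊆ X.1 → ∀ j ∈ (S k).idx Z, DifferentiableOn ℂ (Tc j) O) ∧
        (∀ z ∈ O, ∀ Z : (domSys P M (k + 1)).Dom, Z.1 ⊆ X.1 → ∑ j ∈ (S k).idx Z, ‖Tc j z‖ ≤ A * Real.exp (-(R * torusTreeLen Z.1))) ∧
        (∀ t ∈ Ioc (0 : ℝ) γ, ∀ j, Tc j t = (S k).T j (restrictPrefix k (Function.update g i t)) (emb U))) :
    ∀ (k : ℕ) (g : ℕ → ℝ), g ∈ Window γ → ∀ (U : B) (X : (domSys P M (k + 1)).Dom) (i : ℕ), i < k + 1 →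
      ∃ (Hc : ℂ → (domSys P M (k + 1)).Dom → ℂ) (O : Set ℂ), IsOpen O ∧ (∀ t ∈ Ioc (0 : ℝ) γ, closedBall (t : ℂ) r ⊆ O) ∧
        (∀ Z : (domSys P M (k + 1)).Dom, Z.1 ⊆ X.1 → DifferentiableOn ℂ (fun z => Hc z Z) O) ∧
        (∀ z ∈ O, ∀ Z : (domSys P M (k + 1)).Dom, Z.1 ⊆ X.1 → ‖Hc z Z‖ ≤ A * Real.exp (-(R * torusTreeLen Z.1))) ∧
        (∀ t ∈ Ioc (0 : ℝ) γ, Hc t = (S k).Hh (Function.update g i t) (emb U)) := by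
  intro k g hg U X i hi
  obtain ⟨Tc, O, hO, hdisc, hhol, hmaj, hrep⟩ := hT k g hg U X i hi
  refine ⟨fun z Z => ∑ j ∈ (S k).idx Z, Tc j z, O, hO, hdisc, fun Z hZ => ?_, fun z hz Z hZ => ?_, fun t ht => ?_⟩
  · exact DifferentiableOn.fun_sum fun j hj => hhol Z hZ j hj
  · exact (norm_sum_le _ _).trans (hmaj z hz Z hZ)
  · funext Z
    simp only [ClusterStep.Hh, ClusterStep.H]
    exact Finset.sum_congr rfl fun j _ => hrep t ht j

/-! ## §3 ROAD 3's (A) letter and the printed p. 266 clause for the W1 functional -/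

open Classical in
/-- **ROAD 3's (A) LETTER FOR THE W1 FUNCTIONAL** (any reading map `emb`): young-coupling strip holomorphy of the step activities under one
majorant + S25's located numerals (`r₁ + 2·64·log 162 + 2 ≤ R`, `A·e^{5r₁+1}·K₀(64,8)·9·64 ≤ 1`) + `κ ≤ r₁` ⟹ every young-coupling section of
`W1.functionalOn S p emb` extends holomorphically to a set ⊇ the closed `r`-discs about `]0, γ]` with bound `(e·9·64·K₀(64,8)²·A)·1^{age}·e^{−κ
d(X)}` — §1 then `YMDAG.N22.supLetter_of_activityStrip` BY NAME.  This is the `hA` clause of `n22At_of_oscAnalytic` ∕ `s_N22_of_towerSlot_analytic`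
at `μ = 1` for the OBJECT of record. [folklore] -/
theorem supLetter_functionalOn_of_youngHolo (S : ClusterTower (F.P K) 𝔸 M) (p : RunPairing) {B : Type} (emb : B → CPair (F.P K) 𝔸)
    {γ κ A R r₁ r : ℝ} (hA0 : 0 ≤ A) (hr₁ : 0 ≤ r₁) (hκ : κ ≤ r₁) (hrate : r₁ + 2 * (64 * Real.log 162) + 2 ≤ R)
    (hsmall : A * Real.exp (5 * r₁ + 1) * K₀ 64 8 * 9 * 64 ≤ 1)
    (hYH : ∀ (k : ℕ) (g : ℕ → ℝ), g ∈ Window γ → ∀ (U : B) (X : (domSys (F.P K) M (k + 1)).Dom) (i : ℕ), i < k + 1 →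
      ∃ (Hc : ℂ → (domSys (F.P K) M (k + 1)).Dom → ℂ) (O : Set ℂ), IsOpen O ∧ (∀ t ∈ Ioc (0 : ℝ) γ, closedBall (t : ℂ) r ⊆ O) ∧
        (∀ Z : (domSys (F.P K) M (k + 1)).Dom, Z.1 ⊆ X.1 → DifferentiableOn ℂ (fun z => Hc z Z) O) ∧
        (∀ z ∈ O, ∀ Z : (domSys (F.P K) M (k + 1)).Dom, Z.1 ⊆ X.1 → ‖Hc z Z‖ ≤ A * Real.exp (-(R * torusTreeLen Z.1))) ∧
        (∀ t ∈ Ioc (0 : ℝ) γ, Hc t = (S k).Hh (Function.update g i t) (emb U))) :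
    ∀ g ∈ Window γ, ∀ (U : B) (X : (histCarriers (F.P K) M p).Dom) (i : ℕ), i < (histCarriers (F.P K) M p).scale X →
      ∃ (Fz : ℂ → ℂ) (Dset : Set ℂ), DifferentiableOn ℂ Fz Dset ∧
        (∀ z ∈ Dset, ‖Fz z‖ ≤ Real.exp 1 * 9 * 64 * K₀ 64 8 ^ 2 * A * 1 ^ ((histCarriers (F.P K) M p).scale X - 1 - i) *
          Real.exp (-(κ * (histCarriers (F.P K) M p).d X))) ∧
        (∀ t ∈ Ioc (0 : ℝ) γ, closedBall (t : ℂ) r ⊆ Dset) ∧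
        (∀ t ∈ Ioc (0 : ℝ) γ, Fz t = (functionalOn S p emb (Function.update g i t) U X : ℂ)) :=
  YMDAG.N22.supLetter_of_activityStrip (E := functionalOn S p emb) (domCount (F.P K) M) hA0 hr₁ hrate hsmall
    (hAct_functionalOn_of_youngHolo F K S p emb hκ hYH)

open Classical in
/-- **ROAD 3's (A) LETTER FOR THE FUNCTIONAL OF RECORD `W1.functional S ι p`** (`emb := ofBackgroundC ι`). [folklore] -/
theorem supLetter_functional_of_youngHolo [Ring 𝔸] (S : ClusterTower (F.P K) 𝔸 M) {G : Type} [Group G] (ι : G →* 𝔸ˣ) (p : RunPairing)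
    {γ κ A R r₁ r : ℝ} (hA0 : 0 ≤ A) (hr₁ : 0 ≤ r₁) (hκ : κ ≤ r₁) (hrate : r₁ + 2 * (64 * Real.log 162) + 2 ≤ R)
    (hsmall : A * Real.exp (5 * r₁ + 1) * K₀ 64 8 * 9 * 64 ≤ 1)
    (hYH : ∀ (k : ℕ) (g : ℕ → ℝ), g ∈ Window γ → ∀ (U : GaugeField (F.P K) 0 G) (X : (domSys (F.P K) M (k + 1)).Dom) (i : ℕ), i < k + 1 →
      ∃ (Hc : ℂ → (domSys (F.P K) M (k + 1)).Dom → ℂ) (O : Set ℂ), IsOpen O ∧ (∀ t ∈ Ioc (0 : ℝ) γ, closedBall (t : ℂ) r ⊆ O) ∧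
        (∀ Z : (domSys (F.P K) M (k + 1)).Dom, Z.1 ⊆ X.1 → DifferentiableOn ℂ (fun z => Hc z Z) O) ∧
        (∀ z ∈ O, ∀ Z : (domSys (F.P K) M (k + 1)).Dom, Z.1 ⊆ X.1 → ‖Hc z Z‖ ≤ A * Real.exp (-(R * torusTreeLen Z.1))) ∧
        (∀ t ∈ Ioc (0 : ℝ) γ, Hc t = (S k).Hh (Function.update g i t) (ofBackgroundC ι U))) :
    ∀ g ∈ Window γ, ∀ (U : GaugeField (F.P K) 0 G) (X : (histCarriers (F.P K) M p).Dom) (i : ℕ), i < (histCarriers (F.P K) M p).scale X →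
      ∃ (Fz : ℂ → ℂ) (Dset : Set ℂ), DifferentiableOn ℂ Fz Dset ∧
        (∀ z ∈ Dset, ‖Fz z‖ ≤ Real.exp 1 * 9 * 64 * K₀ 64 8 ^ 2 * A * 1 ^ ((histCarriers (F.P K) M p).scale X - 1 - i) *
          Real.exp (-(κ * (histCarriers (F.P K) M p).d X))) ∧
        (∀ t ∈ Ioc (0 : ℝ) γ, closedBall (t : ℂ) r ⊆ Dset) ∧
        (∀ t ∈ Ioc (0 : ℝ) γ, Fz t = (functional S ι p (Function.update g i t) U X : ℂ)) :=
  supLetter_functionalOn_of_youngHolo F K S p (ofBackgroundC ι) hA0 hr₁ hκ hrate hsmall hYH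

open Classical in
/-- **THE PRINTED [I] p. 266 CLAUSE FOR THE FUNCTIONAL OF RECORD** (direction of record only): young-coupling strip holomorphy of the step
activities under one majorant + S25's numerals + `κ ≤ r₁`, `r > 0` ⟹ `AnalyticInEachCoupling266 (Window γ) (Ioc 0 γ) scale (fun _ => univ)
(W1.functional S ι p)` — every young-coupling section of the functional of record is real-analytic on `]0, γ]` (MIXED §2
`analyticInEachCoupling266_of_activityStrip` BY NAME).  The converse is NE9's unprinted content and is NOT claimed.
[cite: Balaban1987RG1, §2 p.266 (sentence after (2.9))] -/
theorem analyticInEachCoupling266_functional_of_youngHolo [Ring 𝔸] (S : ClusterTower (F.P K) 𝔸 M) {G : Type} [Group G] (ι : G →* 𝔸ˣ)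
    (p : RunPairing) {γ κ A R r₁ r : ℝ} (hA0 : 0 ≤ A) (hr₁ : 0 ≤ r₁) (hκ : κ ≤ r₁) (hrate : r₁ + 2 * (64 * Real.log 162) + 2 ≤ R)
    (hsmall : A * Real.exp (5 * r₁ + 1) * K₀ 64 8 * 9 * 64 ≤ 1) (hr : 0 < r)
    (hYH : ∀ (k : ℕ) (g : ℕ → ℝ), g ∈ Window γ → ∀ (U : GaugeField (F.P K) 0 G) (X : (domSys (F.P K) M (k + 1)).Dom) (i : ℕ), i < k + 1 →
      ∃ (Hc : ℂ → (domSys (F.P K) M (k + 1)).Dom → ℂ) (O : Set ℂ), IsOpen O ∧ (∀ t ∈ Ioc (0 : ℝ) γ, closedBall (t : ℂ) r ⊆ O) ∧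
        (∀ Z : (domSys (F.P K) M (k + 1)).Dom, Z.1 ⊆ X.1 → DifferentiableOn ℂ (fun z => Hc z Z) O) ∧
        (∀ z ∈ O, ∀ Z : (domSys (F.P K) M (k + 1)).Dom, Z.1 ⊆ X.1 → ‖Hc z Z‖ ≤ A * Real.exp (-(R * torusTreeLen Z.1))) ∧
        (∀ t ∈ Ioc (0 : ℝ) γ, Hc t = (S k).Hh (Function.update g i t) (ofBackgroundC ι U))) :
    AnalyticInEachCoupling266 (Window γ) (Ioc 0 γ) (histCarriers (F.P K) M p).scale (fun _ => (Set.univ : Set (GaugeField (F.P K) 0 G)))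
      (functional S ι p) :=
  YMDAG.N22.analyticInEachCoupling266_of_activityStrip (E := functional S ι p) (domCount (F.P K) M) hA0 hr₁ hrate hsmall hr
    (hAct_functional_of_youngHolo F K S ι p hκ hYH)

/-! ## §4 Non-vacuity of the displayed hypothesis (A5 rider) -/

/-- **NON-VACUITY OF THE DISPLAYED HYPOTHESIS (A5 rider).**  The young-coupling strip holomorphy under one majorant is SATISFIABLE: the tower
with NO terms (`idx Z = ∅`, so `H ≡ 0` — the (2.11) sum over no indices) carries it with `Hc ≡ 0`, `O = ℂ`, for every `A ≥ 0`; so §1–§3 are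
not vacuous implications.  (Model tower, NOT NODE 00's.) [folklore] -/
theorem youngHolo_termlessTower {P : Params} {𝔸 : Type*} {M : ℕ} {B : Type} (emb : B → CPair P 𝔸) {γ A R r : ℝ} (hA : 0 ≤ A) :
    ∀ (k : ℕ) (g : ℕ → ℝ), g ∈ Window γ → ∀ (U : B) (X : (domSys P M (k + 1)).Dom) (i : ℕ), i < k + 1 →
      ∃ (Hc : ℂ → (domSys P M (k + 1)).Dom → ℂ) (O : Set ℂ), IsOpen O ∧ (∀ t ∈ Ioc (0 : ℝ) γ, closedBall (t : ℂ) r ⊆ O) ∧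
        (∀ Z : (domSys P M (k + 1)).Dom, Z.1 ⊆ X.1 → DifferentiableOn ℂ (fun z => Hc z Z) O) ∧
        (∀ z ∈ O, ∀ Z : (domSys P M (k + 1)).Dom, Z.1 ⊆ X.1 → ‖Hc z Z‖ ≤ A * Real.exp (-(R * torusTreeLen Z.1))) ∧
        (∀ t ∈ Ioc (0 : ℝ) γ, Hc t =
          ((fun k => (⟨PUnit, fun _ => ∅, fun _ _ _ => 0⟩ : ClusterStep P 𝔸 M k)) k).Hh (Function.update g i t) (emb U)) := by
  intro k g _ U X i _
  refine ⟨fun _ _ => 0, Set.univ, isOpen_univ, fun t _ => subset_univ _, fun Z _ => differentiableOn_const 0,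
    fun z _ Z _ => ?_, fun t _ => ?_⟩
  · rw [norm_zero]; positivity
  · funext Z
    simp [ClusterStep.Hh, ClusterStep.H]

end YMDAG.N22.W1

end
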